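import Mathlib
import HarnessLib
import Summits.RiemannHypothesis.RiemannHypothesis.Theorems.IntegerScrewFloorConstantRH

/-!
# Route `IntegerScrew` — CALIBRATION RECORD: `RH ↔ (c(M))_M bounded below`, with the `¬RH` rate

S-class, w0: an RH-EQUIVALENCE in the tree's vocabulary; 0 toward RH; RH is neither proved nor
used (RULING #517 / director-rh (CA39); junk-trap lemmas after rh-splitx-theory-1 g14's sketch).
`c(M) = screwFloor M = M · inf_{v ≠ 0} vᵀS_Mv/vᵀv`, `S_M = screwMatrix (M − 1)`.
* `bddBelow_screwRayleighSet`, `screwFloor_le_screwRayleigh` — the Rayleigh set of `S_M` is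
  bounded below UNCONDITIONALLY (crude bound `−∑∑|S i j|`), so `sInf` is never the junk value and
  `c(M) ≤ M·vᵀS_Mv/vᵀv` for EVERY `v ≠ 0` (the tree's `screwFloor_le_of_posDef` minus `PosDef`).
* `screwFloor_linear_decay_of_not_riemannHypothesis` — `¬RH → ∃ δ > 0, ∀ᶠ M, c(M) ≤ −δ·M`:
  some `S_n` is not positive SEMIdefinite (`riemannHypothesis_of_screwMatrix_posSemidef`), so
  `xᵀS_nx < 0` for some `x`; zero-padded, `x` tests every larger matrix with the SAME Rayleigh
  quotient (`exists_zeroPad_screwMatrix`; entries depend only on the indices).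
* `riemannHypothesis_iff_bddBelow_screwFloor` — `RH ↔ BddBelow (Set.range screwFloor)`.
  NO SLACK RUNG: a floor profile bounded below by ANY constant is already RH; under `¬RH` the
  `c(M)` fall to `−∞` linearly — the sentence that prices every floor computation of the column.
* `screwFloor_dichotomy` — `(∀ M ≥ 2, 0 < c(M)) ∨ (∃ δ > 0, ∀ᶠ M, c(M) ≤ −δ·M)`.
Nothing in this file bears on the truth of RH.
-/

noncomputable section

set_option linter.dupNamespace false

namespace Summit.RiemannHypothesis.RiemannHypothesis.Theorems.IntegerScrew

open Matrix Filter
open scoped BigOperators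

/-- `w l² ≤ w ⬝ᵥ w`. [folklore] -/
private theorem sq_le_dotProduct_self {k : ℕ} (w : Fin k → ℝ) (l : Fin k) : w l ^ 2 ≤ w ⬝ᵥ w := by
  rw [dotProduct, pow_two]
  exact Finset.single_le_sum (f := fun l => w l * w l) (fun l _ => mul_self_nonneg (w l))
    (Finset.mem_univ l)

/-- `0 < w ⬝ᵥ w` for `w ≠ 0`. [folklore] -/
private theorem dotProduct_self_pos_of_ne_zero {k : ℕ} {w : Fin k → ℝ} (hw : w ≠ 0) : 0 < w ⬝ᵥ w := by
  obtain ⟨i, hi⟩ := Function.ne_iff.mp hw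
  have hpos : 0 < w i ^ 2 := by rw [pow_two]; exact mul_self_pos.mpr hi
  exact hpos.trans_le (sq_le_dotProduct_self w i)

/-- `−(∑∑|S i j|)·(w ⬝ᵥ w) ≤ wᵀSw` for every real square matrix `S`. [folklore] -/
theorem neg_sum_abs_mul_le_quadForm {k : ℕ} (S : Matrix (Fin k) (Fin k) ℝ) (w : Fin k → ℝ) :
    -(∑ i, ∑ j, |S i j|) * (w ⬝ᵥ w) ≤ w ⬝ᵥ (S *ᵥ w) := by
  have hexp : w ⬝ᵥ (S *ᵥ w) = ∑ i, ∑ j, w i * S i j * w j := by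
    simp only [dotProduct, Matrix.mulVec, Finset.mul_sum, mul_assoc]
  rw [hexp, neg_mul, Finset.sum_mul, ← Finset.sum_neg_distrib]
  refine Finset.sum_le_sum fun i _ => ?_
  rw [Finset.sum_mul, ← Finset.sum_neg_distrib]
  refine Finset.sum_le_sum fun j _ => ?_
  have h1 : |w i * S i j * w j| = |S i j| * (|w i| * |w j|) := by rw [abs_mul, abs_mul]; ring
  have h2 : 2 * (|w i| * |w j|) ≤ |w i| ^ 2 + |w j| ^ 2 := by
    nlinarith [sq_nonneg (|w i| - |w j|)]
  rw [sq_abs, sq_abs] at h2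
  have h3 : |S i j| * (|w i| * |w j|) ≤ |S i j| * (w ⬝ᵥ w) := mul_le_mul_of_nonneg_left
    (by linarith [sq_le_dotProduct_self w i, sq_le_dotProduct_self w j]) (abs_nonneg _)
  linarith [neg_abs_le (w i * S i j * w j)]

/-- **JUNK TRAP CLOSED**: the Rayleigh set of `S_M` is bounded below, with no definiteness
hypothesis. [folklore] -/
theorem bddBelow_screwRayleighSet (M : ℕ) :
    BddBelow {q : ℝ | ∃ v : Fin (M - 1) → ℝ, v ≠ 0 ∧ q = screwRayleigh M v} := by
  refine ⟨-(∑ i, ∑ j, |screwMatrix (M - 1) i j|), ?_⟩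
  rintro q ⟨w, hw, rfl⟩
  unfold screwRayleigh
  rw [le_div_iff₀ (dotProduct_self_pos_of_ne_zero hw)]
  exact neg_sum_abs_mul_le_quadForm _ w

/-- **`c(M) ≤ M · vᵀS_Mv/vᵀv` for EVERY `v ≠ 0`** (cf. `screwFloor_le_of_posDef`). [folklore] -/
theorem screwFloor_le_screwRayleigh {M : ℕ} {v : Fin (M - 1) → ℝ} (hv : v ≠ 0) :
    screwFloor M ≤ (M : ℝ) * screwRayleigh M v := by
  unfold screwFloor
  exact mul_le_mul_of_nonneg_left (csInf_le (bddBelow_screwRayleighSet M) ⟨v, hv, rfl⟩)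
    (Nat.cast_nonneg M)

/-- ZERO-PADDING: for `n ≤ N`, every `x : Fin n → ℝ` extends by zeros to `y : Fin N → ℝ` with the
same quadratic form against `screwMatrix` and the same norm. [folklore] -/
theorem exists_zeroPad_screwMatrix {n N : ℕ} (h : n ≤ N) (x : Fin n → ℝ) :
    ∃ y : Fin N → ℝ,
      y ⬝ᵥ (screwMatrix N *ᵥ y) = x ⬝ᵥ (screwMatrix n *ᵥ x) ∧ y ⬝ᵥ y = x ⬝ᵥ x := by
  classical
  let X : ℕ → ℝ := fun k => if hk : k < n then x ⟨k, hk⟩ else 0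
  have hx : x = fun i : Fin n => X i := funext fun i => by simp [X, i.2]
  let F : ℕ → ℕ → ℝ := fun k l => Literature.NumberTheory.LFunctions.zetaScrewKernel
    (Real.log ((k + 2 : ℕ) : ℝ)) (Real.log ((l + 2 : ℕ) : ℝ))
  -- the quadratic form and the norm of `j ↦ X j` on `Fin m`, as sums over `range m`
  have hform : ∀ m : ℕ, (fun j : Fin m => X j) ⬝ᵥ (screwMatrix m *ᵥ fun j : Fin m => X j)
      = ∑ k ∈ Finset.range m, X k * ∑ l ∈ Finset.range m, F k l * X l := fun m => by
    have inner : ∀ j : Fin m, (screwMatrix m *ᵥ fun l : Fin m => X l) j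
        = ∑ l ∈ Finset.range m, F j l * X l := fun j => by
      simp only [Matrix.mulVec, dotProduct, screwMatrix_apply]
      exact Fin.sum_univ_eq_sum_range (fun l => F j l * X l) m
    simp only [dotProduct, inner]
    exact Fin.sum_univ_eq_sum_range (fun k => X k * ∑ l ∈ Finset.range m, F k l * X l) m
  have hnorm : ∀ m : ℕ, (fun j : Fin m => X j) ⬝ᵥ (fun j : Fin m => X j)
      = ∑ k ∈ Finset.range m, X k * X k :=
    fun m => Fin.sum_univ_eq_sum_range (fun k => X k * X k) m
  have hsub : Finset.range n ⊆ Finset.range N := Finset.range_mono h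
  have hout : ∀ k, k ∈ Finset.range N → k ∉ Finset.range n → X k = 0 := fun k _ hk => by
    have hkn : ¬ k < n := fun hlt => hk (Finset.mem_range.2 hlt)
    simp [X, hkn]
  have hinner : ∀ k, ∑ l ∈ Finset.range N, F k l * X l = ∑ l ∈ Finset.range n, F k l * X l :=
    fun k => (Finset.sum_subset hsub fun l hlN hln => by rw [hout l hlN hln, mul_zero]).symm
  refine ⟨fun j => X j, ?_, ?_⟩
  · rw [hx, hform N, hform n]
    simp_rw [hinner]
    exact (Finset.sum_subset hsub fun k hkN hkn => by rw [hout k hkN hkn, zero_mul]).symm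
  · rw [hx, hnorm N, hnorm n]
    exact (Finset.sum_subset hsub fun k hkN hkn => by rw [hout k hkN hkn, zero_mul]).symm

/-- **`¬RH ⟹ ∃ δ > 0, c(M) ≤ −δ·M` for all large `M`.** [folklore] -/
theorem screwFloor_linear_decay_of_not_riemannHypothesis (h : ¬ _root_.RiemannHypothesis) :
    ∃ δ : ℝ, 0 < δ ∧ ∀ᶠ M : ℕ in atTop, screwFloor M ≤ -δ * M := by
  classical
  obtain ⟨n, hn⟩ : ∃ n, ¬ (screwMatrix n).PosSemidef :=
    not_forall.1 fun hall => h (riemannHypothesis_of_screwMatrix_posSemidef hall)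
  obtain ⟨x, hx⟩ : ∃ x : Fin n → ℝ, x ⬝ᵥ (screwMatrix n *ᵥ x) < 0 := by
    by_contra hcon
    exact hn (Matrix.PosSemidef.of_dotProduct_mulVec_nonneg (screwMatrix_isHermitian n)
      fun y => by simpa only [star_trivial] using not_lt.1 (not_exists.1 hcon y))
  have hxx : 0 < x ⬝ᵥ x := dotProduct_self_pos_of_ne_zero (by rintro rfl; simp at hx)
  refine ⟨-(x ⬝ᵥ (screwMatrix n *ᵥ x)) / (x ⬝ᵥ x), div_pos (neg_pos.2 hx) hxx,
    eventually_atTop.2 ⟨n + 1, fun M hM => ?_⟩⟩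
  obtain ⟨y, hyS, hyy⟩ := exists_zeroPad_screwMatrix (show n ≤ M - 1 by omega) x
  have hy0 : y ≠ 0 := fun h0 => by rw [h0, zero_dotProduct] at hyy; linarith
  calc screwFloor M ≤ (M : ℝ) * screwRayleigh M y := screwFloor_le_screwRayleigh hy0
    _ = -(-(x ⬝ᵥ (screwMatrix n *ᵥ x)) / (x ⬝ᵥ x)) * M := by
      unfold screwRayleigh
      rw [hyS, hyy, neg_div, neg_neg, mul_comm]

/-- **CALIBRATION: `RH ↔ (c(M))_M is bounded below`** — no slack rung between «bounded below by
some constant» and RH (`c(M) > 0` for `M ≥ 2` under RH; `c(M) ≤ −δ·M` eventually under `¬RH`).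
[folklore] -/
theorem riemannHypothesis_iff_bddBelow_screwFloor :
    _root_.RiemannHypothesis ↔ BddBelow (Set.range screwFloor) := by
  constructor
  · intro hRH
    refine ⟨min (min (screwFloor 0) (screwFloor 1)) 0, ?_⟩
    rintro c ⟨M, rfl⟩
    rcases Nat.lt_or_ge M 2 with hM | hM
    · interval_cases M
      · exact (min_le_left _ _).trans (min_le_left _ _)
      · exact (min_le_left _ _).trans (min_le_right _ _)
    · exact (min_le_right _ _).trans
        ((riemannHypothesis_iff_screwFloor_pos_two_le.1 hRH) M hM).le
  · rintro ⟨b, hb⟩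
    by_contra hRH
    obtain ⟨δ, hδ, hev⟩ := screwFloor_linear_decay_of_not_riemannHypothesis hRH
    obtain ⟨M₀, hM₀⟩ := eventually_atTop.1 hev
    obtain ⟨K, hK⟩ := exists_nat_gt (-b / δ)
    have hKδ : -b < (K : ℝ) * δ := (div_lt_iff₀ hδ).1 hK
    have hbM : b ≤ screwFloor (max M₀ K) := hb ⟨max M₀ K, rfl⟩
    have hdec : screwFloor (max M₀ K) ≤ -δ * (max M₀ K : ℕ) := hM₀ _ (le_max_left _ _)
    have hKM : (K : ℝ) ≤ (max M₀ K : ℕ) := by exact_mod_cast le_max_right M₀ K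
    nlinarith

/-- **THE DICHOTOMY**: every `c(M)`, `M ≥ 2`, is positive (RH), or `c(M) ≤ −δ·M` for all large `M`
with some `δ > 0` (`¬RH`). [folklore] -/
theorem screwFloor_dichotomy :
    (∀ M : ℕ, 2 ≤ M → 0 < screwFloor M) ∨
      ∃ δ : ℝ, 0 < δ ∧ ∀ᶠ M : ℕ in atTop, screwFloor M ≤ -δ * M :=
  (em _root_.RiemannHypothesis).imp riemannHypothesis_iff_screwFloor_pos_two_le.1
    screwFloor_linear_decay_of_not_riemannHypothesis

end Summit.RiemannHypothesis.RiemannHypothesis.Theorems.IntegerScrew
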